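import Summits.QuantumFields.BalabanUV.T4Continuum.Support.NE7MajorantColumnSums
import Summits.QuantumFields.BalabanUV.T4Continuum.Support.NE3TopRadiusLetters

/-!
# NE7ColumnLineClass — THE COLUMN LINE `d·L^{d−1}·Ssum d L (j+1) x ≤ 1∕2` OF F228∕F229∕F230 (the `c_Q*` regime) IS A k-FREE CLASS LINE: `LevelSmall d L j x`, `(L^{j+1})²x ≤ θ` and
# `(4∕3)·17·d·(d+1)·(d+4)·L^{d−1}·Csup d L·θ ≤ 1∕2` imply it; at `d = 4`, `L = 2` it holds for every level radius with `(2^{j+1})²x ≤ θ ≤ 10⁻¹¹` (so in particular on the SU(2) class of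
# F226∕F227 with `θ = 10⁻⁵³`) (file 161 of the curved (APE), F231)

Cell `pub-balaban`, rung (B)+1 sub-cell t4, lineage `b2b-balaban-t4-ne7-p1` (CRUX PROVER NE7 #1 = OWNER of row NE7), generation 86; memo
`t4/b2b-balaban-t4-ne7-p1-g86/ORBIT-COMPARISON.md` §6.  Over row NE3-R2's `NE3CovariantLineSumsError.Ssum_le_one` (`Ssum (j+1) x ≤ (4∕3)·wC(x_j)`), `NE3TopRadiusLetters.iterate_prop1Radius_le_of_levelSmall`
(`x_j ≤ (17∕16)(L²)^j x`) BY NAME.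
WHAT ([folklore]; 0 def, 0 sorry).  `colLine_of_line` (k-free), `colLine_d4_L2` (numeric at `d = 4`, `L = 2`, `θ ≤ 10⁻¹¹`).
HONEST FRAMING (page 1): elementary real arithmetic on OUR radius recursion; the last displayed smallness of F230 that is not one of row NE3-R2's own lines is hereby a class line; nothing of
Bałaban's asserted; the rows A₀, A₁, A_E remain DISPLAYED; NE7 NOT PROVED; spine 0∕9; finite T⁴ rung (B)+1 — NOT infinite volume, NOT mass gap, NOT `BetaPertH`, NOT Clay.  Continuum YM on
T⁴ ⇐ BetaPertH ∧ nine spine estimates (0/9 proved); BetaPertH ⇐ (D1) ∧ (D4) ∧ CAP+tail; G-an2-4 gates asym, D1 and NE2/3/4.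
-/

set_option autoImplicit false

namespace Summit.QuantumFields.BalabanUV.T4Continuum.NE7ColumnLineClass

open Literature.MathematicalPhysics.QuantumFieldTheory.Balaban1983to89
open B7Prop2Explicit
open AveragingDeficitTwoLevelPrep (prop1Radius)
open AveragingDeficitMultiLevelPrep (LevelSmall)
open BlockAverageVaryHolo (nbRad)
open NE3CovariantLineSumsError (Csup Csup_nonneg wC Ssum Ssum_le_one iterate_prop1Radius_nonneg)
open NE3TopRadiusLetters (iterate_prop1Radius_le_of_levelSmall)

noncomputable section

variable {d : ℕ}

/-- **THE COLUMN LINE FROM ONE k-FREE LINE**: `L ≥ 2`, `0 ≤ x`, `LevelSmall d L j x`, `(L^{j+1})²x ≤ θ`, `(4∕3)·17·d·(d+1)·(d+4)·L^{d−1}·Csup d L·θ ≤ 1∕2` ⟹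
`d·L^{d−1}·Ssum d L (j+1) x ≤ 1∕2`. [folklore] -/
theorem colLine_of_line {L : ℕ} (hL : 2 ≤ L) (j : ℕ) {x θ : ℝ} (hx : 0 ≤ x) (hs : LevelSmall d L j x) (hθ : ((L : ℝ) ^ (j + 1)) ^ 2 * x ≤ θ)
    (hline : 4 / 3 * 17 * (d : ℝ) * (((d : ℝ) + 1) * ((d : ℝ) + 4)) * (L : ℝ) ^ (d - 1) * Csup d L * θ ≤ 1 / 2) :
    (d : ℝ) * (L : ℝ) ^ (d - 1) * Ssum d L (j + 1) x ≤ 1 / 2 := by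
  have hL0 : (0 : ℝ) < L := by exact_mod_cast (show 0 < L by omega)
  have hS := (Ssum_le_one (d := d) hL hx hs).1
  have hr := iterate_prop1Radius_le_of_levelSmall (d := d) hL j hx hs
  have hr0 : 0 ≤ (prop1Radius d L)^[j] x := iterate_prop1Radius_nonneg (d := d) j hx
  have hC := Csup_nonneg d L
  -- `x_j ≤ (17/16)·(L²)^j·x = (17/16)·(L^{j+1})²x / L² ≤ (17/16)·θ / L²`
  have hxj : (prop1Radius d L)^[j] x ≤ 17 / 16 * θ / (L : ℝ) ^ 2 := by
    have e : ((L : ℝ) ^ 2) ^ j * x = ((L : ℝ) ^ (j + 1)) ^ 2 * x / (L : ℝ) ^ 2 := by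
      field_simp; ring
    rw [e] at hr
    calc (prop1Radius d L)^[j] x ≤ 17 / 16 * (((L : ℝ) ^ (j + 1)) ^ 2 * x / (L : ℝ) ^ 2) := hr
      _ ≤ 17 / 16 * (θ / (L : ℝ) ^ 2) := by gcongr
      _ = 17 / 16 * θ / (L : ℝ) ^ 2 := by ring
  -- `wC(x_j) = 16(d+1)(d+4)L²x_j·Csup ≤ 17(d+1)(d+4)·Csup·θ`
  have hw : wC d L ((prop1Radius d L)^[j] x) ≤ 17 * (((d : ℝ) + 1) * ((d : ℝ) + 4)) * Csup d L * θ := by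
    unfold wC
    have h16 : (0 : ℝ) ≤ 16 * (d + 1) * (d + 4) * (L : ℝ) ^ 2 := by positivity
    calc 16 * ((d : ℝ) + 1) * ((d : ℝ) + 4) * (L : ℝ) ^ 2 * (prop1Radius d L)^[j] x * Csup d L
        ≤ 16 * ((d : ℝ) + 1) * ((d : ℝ) + 4) * (L : ℝ) ^ 2 * (17 / 16 * θ / (L : ℝ) ^ 2) * Csup d L := by gcongr
      _ = 17 * (((d : ℝ) + 1) * ((d : ℝ) + 4)) * Csup d L * θ := by field_simp
  have hdL : (0 : ℝ) ≤ (d : ℝ) * (L : ℝ) ^ (d - 1) := by positivity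
  calc (d : ℝ) * (L : ℝ) ^ (d - 1) * Ssum d L (j + 1) x
      ≤ (d : ℝ) * (L : ℝ) ^ (d - 1) * (4 / 3 * wC d L ((prop1Radius d L)^[j] x)) := mul_le_mul_of_nonneg_left hS hdL
    _ ≤ (d : ℝ) * (L : ℝ) ^ (d - 1) * (4 / 3 * (17 * (((d : ℝ) + 1) * ((d : ℝ) + 4)) * Csup d L * θ)) := by gcongr
    _ = 4 / 3 * 17 * (d : ℝ) * (((d : ℝ) + 1) * ((d : ℝ) + 4)) * (L : ℝ) ^ (d - 1) * Csup d L * θ := by ring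
    _ ≤ 1 / 2 := hline

/-- **AT `d = 4`, `L = 2`**: the column line holds at every level radius `x` of the class with `(2^{j+1})²x ≤ θ ≤ 10⁻¹¹` (`Csup 4 2 = 27568`; the k-free line reads `≈ 8·10⁸·θ ≤ 1∕2`).
[folklore] -/
theorem colLine_d4_L2 (j : ℕ) {x θ : ℝ} (hx : 0 ≤ x) (hs : LevelSmall 4 2 j x) (hθ : (((2 : ℕ) : ℝ) ^ (j + 1)) ^ 2 * x ≤ θ) (hθ' : θ ≤ 1 / 10 ^ 11) :
    ((4 : ℕ) : ℝ) * (((2 : ℕ) : ℝ)) ^ (4 - 1) * Ssum 4 2 (j + 1) x ≤ 1 / 2 := by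
  refine colLine_of_line (d := 4) (by norm_num) j hx hs hθ ?_
  have hθ0 : 0 ≤ θ := le_trans (by positivity) hθ
  unfold Csup nbRad
  push_cast
  nlinarith [hθ', hθ0]

end

end Summit.QuantumFields.BalabanUV.T4Continuum.NE7ColumnLineClass
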